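import Literature.NumberTheory.Automorphic.Liu2021.Def45RMuGalois
import Literature.AlgebraicGeometry.Deligne1982.EtaleAlgebraTraceDuality
import Mathlib.RingTheory.Trace.Basic
import Mathlib.RingTheory.TensorProduct.Free
import Mathlib.LinearAlgebra.Matrix.BilinearForm
import HarnessLib

/-!
# [Liu 2021] Definition 4.5 (2), fourth bullet — `r_μ` EXISTS, as printed, for every abstract de Rham datum at every face of a Galois CM field

Y. Liu, *Fourier–Jacobi cycles and arithmetic relative trace formula*, Camb. J. Math. **9** (2021) = arXiv:2102.11518
[Liu2021]; TeX source `FJcycle.tex` (md5 `6db49a74122d…`), §4.1, Def. 4.5 (2) fourth bullet (l. 1957), VERBATIM: «• `r_μ :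
M_μ ⊗_ℚ E → H_1^{dR}(A_μ/E)` is an isomorphism of `M_μ ⊗_ℚ E`-modules satisfying that there exist an element `β ∈ M_μ` and an
isomorphism `c : H^{dR}_{2 dim A_μ}(A_μ/E) → E` of `E`-modules, such that for every `x, y ∈ M_μ ⊗_ℚ E`, we have
`c(⟨r_μ(x), r_μ(y)⟩_λ) = Tr_{M_μ ⊗_ℚ E/E}(x β ȳ)`, where `⟨ , ⟩_λ […]` denotes the pairing induced by `λ`»; proof of Prop. 4.6 (1),
l. 1982: «The existence of `r_μ` is obvious».  Red-team WATCH W1, r-half (pub-hodgecm2 `HOME/pinning/HCMISOG-TABLE.md` sub-row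
(CP-S4c-P)); sequel of `Liu2021/Def45RMuGalois` (hcmisog-isog-2 gen 3: the norm obstruction vanishes at every Galois face).

WHAT THIS FILE DECIDES — the «obvious» of l. 1982 as a kernel theorem, modulo the de Rham CARRIER only.  `K = M_μ ⊆ ℂ`
(`muAlgValueField F μ`, a CM field), `ρ` its complex conjugation, `E = F` Liu's CM field, `L = F ⊗_ℚ M_μ` (the tree's
scalar-left orientation of `M_μ ⊗_ℚ E`; `Algebra.TensorProduct.comm`), `ȳ = (1 ⊗ ρ) y`.  An ABSTRACT DE RHAM DATUM for `μ`:
an `L`-module `H` with an `L`-linear isomorphism `e : L ≃ H` (rank-one freeness; for `H_1^{dR}(A_μ/E)`: Betti comparison +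
`[M_μ : ℚ] = 2 dim A_μ`) and an `F`-bilinear form `B` on `H` (= `c ∘ ⟨ , ⟩_λ`) that is ALTERNATING, NON-DEGENERATE and satisfies
`B((1 ⊗ x) u, v) = B(u, (1 ⊗ x̄) v)`, `x ∈ M_μ` — the third bullet «`λ ∘ i_μ(x) = i_μ(x̄)^∨ ∘ λ`» (l. 1955) read on `H_1^{dR}`
through `⟨ , ⟩_λ`.  **THEOREM** `exists_linearEquiv_forall₂_eq_trace_muAlgValueField`: for `F` GALOIS over `ℚ`, `μ` ANY
conjugate symplectic character, EVERY abstract de Rham datum `(H, e, B)` and EVERY `β ∈ M_μ` with `ρ β = -β`, `β ≠ 0`, there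
is an `L`-linear isomorphism `r : L ≃ H` with `B(r x, r y) = Tr_{L/F}(x (1 ⊗ β) ȳ)` for all `x, y` — the printed fourth bullet
for `(H, B)` (Liu's `c` absorbed into `B`).  Companion `Liu2021/Def45RMuExistsNonVacuity`: such `β` exist, the printed-shape
corollary «there exist `β ∈ M_μ` and …», and joint satisfiability of the hypotheses at Liu's data.  Hence at every face admitted
by the cells' END displays (`IsGalois ℚ F`) the de Rham token `R`/`hR` of `Def45.PolDR` (`Liu2021/Def45Polarisation`) is
inhabited IN PRINT'S SENSE by any model of `H_1^{dR}(A_μ/E)` with its `λ`-pairing; CARRIER-level remains only the existence of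
that model (algebraic de Rham homology of `A_μ/E` with its `M_μ`-action, free of rank one over `L`, with the alternating
perfect pairing of the polarisation) — not the normalisation.

MECHANISM (§1–§3, pure algebra over `L = E ⊗_ℚ K`; §2–§3 private): the trace form of `L/E` is non-degenerate; a form with the
adjunction is `Tr_{L/E}(x β₀ ȳ)` (trace duality, [Deligne1982HodgeCycles] Lemma 4.3 (a) = tree `Deligne1982.traceCompDualEquiv`;
the de Rham analogue of [Shimura1998] §6.2, «`E(v(α), v(β)) = Tr_{K/ℚ}(ζαβ^ρ)`» and Thm. 4 (3)), alternating ⇒ `β̄₀ = -β₀`, non-degenerate ⇒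
`β₀ ∈ L^×`; then `(1 ⊗ β) β₀⁻¹` is `bar`-fixed, hence `= a ā` by gen-3's `exists_mul_map_eq_muAlgValueField` (§4, transported
to the `F ⊗ M_μ` orientation), and `r(x) := e(x a)`.  GENERAL-ALGEBRA LAYER OF RECORD (same mathematics, found
independently, pub-hodgecm2 lead HOME/INBOX l.7635 (c) / l.7695 «one headline — two layers»): b25's
`Summits/HodgeConjecture/CorCM/RMuNormTraceForm.lean` (`exists_eq_trace_mul_mul_map`, capstone `exists_generator_eq_trace`)
over `RMuNormFixedUnits` / `RMuNormOddUnit` / `RMuNormHermitianUnits`; a Literature file cannot import `Summits`, so the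
algebra is inlined here (§2–§3 PRIVATE) and THIS file states the [Liu2021]-level reading at Liu's data only (§4, public).

HONEST SCOPE.  Nothing here constructs `H_1^{dR}(A_μ/E)`, Liu's `X_K`, `A_K`, `Ω(μ)`, or touches `hM`; no END display binder is
discharged (`R`/`hR` stay displayed by the CM-side owner's position (α′), HOME/INBOX l.7627; `R := PUnit` stays excluded by
convention, htheta-x2 HOME/INBOX l.7877); HC_CM is NOT proved.  No named fact, no `def` (D-0026 debt 0).

References: [Liu2021] §4.1 l. 1928 (`M_μ`), Def. 4.5 (2) (TeX ll. 1944–1958; bullet 3 l. 1955, bullet 4 l. 1957), proof of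
Prop. 4.6 (1) (l. 1982); [Shimura1998] G. Shimura, *Abelian Varieties with Complex Multiplication and Modular Functions* (1998),
§6.2 («`E(v(α), v(β)) = Tr_{K/ℚ}(ζαβ^ρ)`», Theorem 4 (3) and its converse); [Deligne1982HodgeCycles] P. Deligne, *Hodge cycles on abelian
varieties*, LNM 900 (1982), §4 Lemma 4.3 (a).
-/

set_option autoImplicit false

noncomputable section

open scoped TensorProduct ComplexConjugate
open Module NumberField

namespace Literature.NumberTheory.Automorphic.Liu2021.Def45

/-! ## §1 The trace form of `E ⊗_ℚ K` over `E` is non-degenerate -/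

section TraceForm

variable (E K : Type) [Field E] [Algebra ℚ E] [Field K] [NumberField K]

/-- §1: the trace form of `L = E ⊗_ℚ K` over `E` is non-degenerate (Gram matrix in the basis `1 ⊗ b_i` = image of
`(Tr_{K/ℚ}(b_i b_j))`, `det ≠ 0` by separability; base change of traces).  General-algebra layer of record: b25's
`Summit.HodgeConjecture.CorCM.RMuNorm` (`CorCM/RMuNormTraceForm.lean`, `traceForm_baseChange_nondegenerate`) — inlined here because a
Literature file cannot import `Summits`. [cite: Deligne1982HodgeCycles, §4 Lemma 4.3 («étale k-algebra»)] -/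
theorem traceForm_tensorProduct_nondegenerate : (Algebra.traceForm E (E ⊗[ℚ] K)).Nondegenerate := by
  classical
  let b := Module.finBasis ℚ K
  refine LinearMap.BilinForm.nondegenerate_of_det_ne_zero (Algebra.traceForm E (E ⊗[ℚ] K))
    (Algebra.TensorProduct.basis E b) ?_
  have hM : LinearMap.BilinForm.toMatrix (Algebra.TensorProduct.basis E b) (Algebra.traceForm E (E ⊗[ℚ] K)) =
      (algebraMap ℚ E).mapMatrix (LinearMap.BilinForm.toMatrix b (Algebra.traceForm ℚ K)) := by
    ext i j
    rw [RingHom.mapMatrix_apply, Matrix.map_apply, LinearMap.BilinForm.toMatrix_apply,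
      LinearMap.BilinForm.toMatrix_apply, Algebra.traceForm_apply, Algebra.traceForm_apply,
      Algebra.TensorProduct.basis_apply, Algebra.TensorProduct.basis_apply,
      Algebra.TensorProduct.tmul_mul_tmul, one_mul, Algebra.trace_apply, Algebra.trace_apply,
      ← Algebra.baseChange_lmul, LinearMap.trace_baseChange]
  rw [hM, ← RingHom.map_det]
  exact (map_ne_zero_iff _ (algebraMap ℚ E).injective).mpr (det_traceForm_ne_zero b)

/-- §1: an element of `E ⊗_ℚ K` all of whose multiples have trace zero over `E` is zero. [cite: Deligne1982HodgeCycles, §4 Lemma 4.3 (a)] -/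
theorem eq_zero_of_forall_trace_mul_eq_zero {a : E ⊗[ℚ] K}
    (h : ∀ z : E ⊗[ℚ] K, Algebra.trace E (E ⊗[ℚ] K) (a * z) = 0) : a = 0 :=
  (traceForm_tensorProduct_nondegenerate E K).1 a fun z => by rw [Algebra.traceForm_apply]; exact h z

end TraceForm

/-! ## §2 `E`-bilinear forms on `L = E ⊗_ℚ K` with the Rosati adjunction are trace forms `Tr_{L/E}(x β₀ ȳ)` -/

section RosatiForms

variable {E K : Type} [Field E] [Algebra ℚ E] [Field K] [NumberField K] (ρ : K →ₐ[ℚ] K)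

/-- `1 ⊗ ρ` is an involution of `E ⊗_ℚ K`. [cite: Liu2021, §4.1 (TeX l. 1928)] -/
theorem map_map_tensorProduct_of_involutive (hρ : ∀ x, ρ (ρ x) = x) (z : E ⊗[ℚ] K) :
    Algebra.TensorProduct.map (AlgHom.id E E) ρ (Algebra.TensorProduct.map (AlgHom.id E E) ρ z) = z := by
  induction z using TensorProduct.induction_on with
  | zero => simp
  | tmul e x => rw [Algebra.TensorProduct.map_tmul, Algebra.TensorProduct.map_tmul, AlgHom.id_apply, AlgHom.id_apply, hρ]
  | add z₁ z₂ h₁ h₂ => rw [map_add, map_add, h₁, h₂]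

/-- `Tr_{L/E} ∘ (1 ⊗ ρ) = Tr_{L/E}` (an `E`-algebra automorphism). [cite: Liu2021, Def. 4.5 (2) fourth bullet (TeX l. 1957)] -/
theorem trace_map_tensorProduct_of_involutive (hρ : ∀ x, ρ (ρ x) = x) (z : E ⊗[ℚ] K) :
    Algebra.trace E (E ⊗[ℚ] K) (Algebra.TensorProduct.map (AlgHom.id E E) ρ z) = Algebra.trace E (E ⊗[ℚ] K) z := by
  set bar := Algebra.TensorProduct.map (AlgHom.id E E) ρ with hbar
  have hbb : bar.comp bar = AlgHom.id E (E ⊗[ℚ] K) :=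
    AlgHom.ext fun z => map_map_tensorProduct_of_involutive ρ hρ z
  exact Algebra.trace_eq_of_algEquiv (AlgEquiv.ofAlgHom bar bar hbb hbb) z

/-- The third-bullet adjunction for pure elements `1 ⊗ x` extends `E`-bilinearly: `B(ℓ u, v) = B(u, ℓ̄ v)` for all `ℓ ∈ L`.
[cite: Liu2021, Def. 4.5 (2) third bullet (TeX l. 1955)] -/
private theorem apply_mul_eq_apply_map_mul (B : LinearMap.BilinForm E (E ⊗[ℚ] K))
    (hB : ∀ (x : K) (u v : E ⊗[ℚ] K),
      B (((1 : E) ⊗ₜ[ℚ] x) * u) v = B u (((1 : E) ⊗ₜ[ℚ] ρ x) * v))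
    (ℓ u v : E ⊗[ℚ] K) :
    B (ℓ * u) v = B u (Algebra.TensorProduct.map (AlgHom.id E E) ρ ℓ * v) := by
  induction ℓ using TensorProduct.induction_on with
  | zero => simp
  | tmul e x =>
    have h1 : (e ⊗ₜ[ℚ] x : E ⊗[ℚ] K) = e • ((1 : E) ⊗ₜ[ℚ] x) := by
      rw [TensorProduct.smul_tmul', smul_eq_mul, mul_one]
    have h2 : (e ⊗ₜ[ℚ] ρ x : E ⊗[ℚ] K) = e • ((1 : E) ⊗ₜ[ℚ] ρ x) := by
      rw [TensorProduct.smul_tmul', smul_eq_mul, mul_one]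
    rw [Algebra.TensorProduct.map_tmul, AlgHom.id_apply, h1, h2, smul_mul_assoc, smul_mul_assoc, map_smul,
      LinearMap.smul_apply, LinearMap.map_smul, hB]
  | add ℓ₁ ℓ₂ h₁ h₂ => rw [add_mul, map_add, LinearMap.add_apply, h₁, h₂, map_add, add_mul, map_add]

/-- §2: every `E`-bilinear form on `L = E ⊗_ℚ K` with the third-bullet adjunction is a trace form `Tr_{L/E}(x β₀ ȳ)`
(`B(x, y) = B(1, x̄ y)`; `B(1, ·) = Tr(γ ·)` by trace duality, tree `Deligne1982.traceCompDualEquiv`; `β₀ = γ̄`).  The de Rham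
analogue of [Shimura1998] §6.2 «`E(v(α), v(β)) = Tr_{K/ℚ}(ζαβ^ρ)`» and Thm. 4 (3) with its converse; general-algebra layer of record: b25's `exists_eq_trace_mul_mul_map`
(`CorCM/RMuNormTraceForm.lean`), inlined here (Literature cannot import `Summits`).
[cite: Liu2021, Def. 4.5 (2) fourth bullet (TeX l. 1957)] [cite: Shimura1998, §6.2 Theorem 4] [cite: Deligne1982HodgeCycles, §4 Lemma 4.3 (a)] -/
private theorem exists_forall₂_eq_trace (hρ : ∀ x, ρ (ρ x) = x) (B : LinearMap.BilinForm E (E ⊗[ℚ] K))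
    (hB : ∀ (x : K) (u v : E ⊗[ℚ] K),
      B (((1 : E) ⊗ₜ[ℚ] x) * u) v = B u (((1 : E) ⊗ₜ[ℚ] ρ x) * v)) :
    ∃ β₀ : E ⊗[ℚ] K, ∀ x y : E ⊗[ℚ] K,
      B x y = Algebra.trace E (E ⊗[ℚ] K) (x * β₀ * Algebra.TensorProduct.map (AlgHom.id E E) ρ y) := by
  classical
  set bar := Algebra.TensorProduct.map (AlgHom.id E E) ρ with hbar
  have hbb : ∀ z, bar (bar z) = z := map_map_tensorProduct_of_involutive ρ hρ
  have htr : ∀ z, Algebra.trace E (E ⊗[ℚ] K) (bar z) = Algebra.trace E (E ⊗[ℚ] K) z :=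
    trace_map_tensorProduct_of_involutive ρ hρ
  have hL : ∀ ℓ u v, B (ℓ * u) v = B u (bar ℓ * v) := apply_mul_eq_apply_map_mul ρ B hB
  have hnd := traceForm_tensorProduct_nondegenerate E K
  -- the functional `B(1, ·)` is `Tr(γ ·)`
  set γ : E ⊗[ℚ] K :=
    (Literature.AlgebraicGeometry.Deligne1982.traceCompDualEquiv E (E ⊗[ℚ] K) (E ⊗[ℚ] K) hnd).symm (B 1) 1 with hγ_def
  have hγ : ∀ z, Algebra.trace E (E ⊗[ℚ] K) (γ * z) = B 1 z := fun z => by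
    have h := Literature.AlgebraicGeometry.Deligne1982.trace_traceCompDualEquiv_symm_mul E (E ⊗[ℚ] K) (E ⊗[ℚ] K)
      hnd (B 1) 1 z
    rwa [smul_eq_mul, mul_one] at h
  refine ⟨bar γ, fun x y => ?_⟩
  calc B x y = B (x * 1) y := by rw [mul_one]
    _ = B 1 (bar x * y) := hL x 1 y
    _ = Algebra.trace E (E ⊗[ℚ] K) (γ * (bar x * y)) := (hγ _).symm
    _ = Algebra.trace E (E ⊗[ℚ] K) (bar (bar γ * x * bar y)) := by
        rw [map_mul bar, map_mul bar, hbb, hbb]; congr 1; ring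
    _ = Algebra.trace E (E ⊗[ℚ] K) (bar γ * x * bar y) := htr _
    _ = Algebra.trace E (E ⊗[ℚ] K) (x * bar γ * bar y) := by congr 1; ring

/-- §2: `B = Tr(x β₀ ȳ)` alternating ⇒ `β̄₀ = -β₀` (`Tr((β₀ + β̄₀) x) = 0` for all `x`, §1). [cite: Liu2021, Def. 4.5 (2) fourth bullet (TeX l. 1957)] [cite: Shimura1998, §6.2 («ζ^ρ = -ζ») and Theorem 4] -/
private theorem map_eq_neg_of_isAlt (hρ : ∀ x, ρ (ρ x) = x) (B : LinearMap.BilinForm E (E ⊗[ℚ] K)) {β₀ : E ⊗[ℚ] K}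
    (hβ₀ : ∀ x y : E ⊗[ℚ] K,
      B x y = Algebra.trace E (E ⊗[ℚ] K) (x * β₀ * Algebra.TensorProduct.map (AlgHom.id E E) ρ y))
    (hAlt : B.IsAlt) :
    Algebra.TensorProduct.map (AlgHom.id E E) ρ β₀ = -β₀ := by
  set bar := Algebra.TensorProduct.map (AlgHom.id E E) ρ with hbar
  have hbb : ∀ z, bar (bar z) = z := map_map_tensorProduct_of_involutive ρ hρ
  have htr : ∀ z, Algebra.trace E (E ⊗[ℚ] K) (bar z) = Algebra.trace E (E ⊗[ℚ] K) z :=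
    trace_map_tensorProduct_of_involutive ρ hρ
  have hsum : β₀ + bar β₀ = 0 := by
    refine eq_zero_of_forall_trace_mul_eq_zero E K fun z => ?_
    have h1 : B z 1 = Algebra.trace E (E ⊗[ℚ] K) (β₀ * z) := by
      rw [hβ₀, map_one bar, mul_one, mul_comm]
    have h2 : B 1 z = Algebra.trace E (E ⊗[ℚ] K) (bar β₀ * z) := by
      rw [hβ₀, one_mul, ← htr (bar β₀ * z), map_mul bar, hbb]
    have h3 : -B z 1 = B 1 z := hAlt.neg_eq z 1
    rw [add_mul, map_add, ← h1, ← h2, ← h3, add_neg_cancel]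
  exact eq_neg_of_add_eq_zero_right hsum

/-- §2: `B = Tr(x β₀ ȳ)` right-separating ⇒ `β₀ ∈ L^×` (else `β₀ z = 0`, `z ≠ 0`, and `z̄` is in the right kernel).
[cite: Liu2021, Def. 4.5 (2) fourth bullet (TeX l. 1957)] -/
private theorem isUnit_of_separatingRight (hρ : ∀ x, ρ (ρ x) = x) (B : LinearMap.BilinForm E (E ⊗[ℚ] K))
    {β₀ : E ⊗[ℚ] K}
    (hβ₀ : ∀ x y : E ⊗[ℚ] K,
      B x y = Algebra.trace E (E ⊗[ℚ] K) (x * β₀ * Algebra.TensorProduct.map (AlgHom.id E E) ρ y))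
    (hNd : ∀ y : E ⊗[ℚ] K, (∀ x, B x y = 0) → y = 0) : IsUnit β₀ := by
  set bar := Algebra.TensorProduct.map (AlgHom.id E E) ρ with hbar
  have hbb : ∀ z, bar (bar z) = z := map_map_tensorProduct_of_involutive ρ hρ
  by_contra hu
  -- multiplication by a non-unit of the finite-dimensional commutative `E`-algebra `L` kills a non-zero element
  obtain ⟨z, hz, hz0⟩ : ∃ z : E ⊗[ℚ] K, β₀ * z = 0 ∧ z ≠ 0 := by
    by_contra hc
    push Not at hc
    have hinj : Function.Injective (LinearMap.mulLeft E β₀) := by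
      intro a b hab
      rw [LinearMap.mulLeft_apply, LinearMap.mulLeft_apply] at hab
      have h0 : β₀ * (a - b) = 0 := by rw [mul_sub, hab, sub_self]
      exact sub_eq_zero.mp (hc (a - b) h0)
    obtain ⟨w, hw⟩ := LinearMap.surjective_of_injective hinj 1
    rw [LinearMap.mulLeft_apply] at hw
    exact hu (IsUnit.of_mul_eq_one w hw)
  have hker : ∀ x, B x (bar z) = 0 := fun x => by
    rw [hβ₀, hbb, mul_assoc, hz, mul_zero, map_zero]
  have hbz : bar z = 0 := hNd (bar z) hker
  exact hz0 (by rw [← hbb z, hbz, map_zero])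

/-- For a ring endomorphism `f` and a unit `u` with `f u = -u`: `f u⁻¹ = -u⁻¹`. [cite: Liu2021, Def. 4.5 (2) fourth bullet (TeX l. 1957)] -/
private theorem map_units_inv_eq_neg {R : Type} [CommRing R] {Φ : Type} [FunLike Φ R R] [RingHomClass Φ R R]
    (f : Φ) (u : Rˣ) (hu : f u = -u) : f ↑u⁻¹ = -↑u⁻¹ := by
  have h1 : f ↑u⁻¹ * (-(u : R)) = 1 := by rw [← hu, ← map_mul f, Units.inv_mul, map_one f]
  calc f ↑u⁻¹ = f ↑u⁻¹ * ((u : R) * ↑u⁻¹) := by rw [Units.mul_inv, mul_one]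
    _ = -(f ↑u⁻¹ * (-(u : R))) * ↑u⁻¹ := by ring
    _ = -↑u⁻¹ := by rw [h1]; ring

/-! ## §3 `r_μ` exists for every abstract de Rham datum, granted the norm property of `L` -/

/-- §3: **`r_μ` exists for every abstract de Rham datum, GRANTED the norm property `hN` of `L`** (every `bar`-fixed element
is `a ā`; decided for `E/ℚ` Galois by `Def45RMuGalois`): pull `B` back along `e`, write it `Tr(x β₀ ȳ)` (§2) with `β₀` an
anti-invariant unit, get `(1 ⊗ β) β₀⁻¹ = a ā` from `hN`, and put `r(x) := e(x a)`.  General-algebra layer of record: b25's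
capstone `exists_generator_eq_trace` (`CorCM/RMuNormTraceForm.lean`), inlined here (Literature cannot import `Summits`).
[cite: Liu2021, Def. 4.5 (2) fourth bullet (TeX l. 1957) and proof of Prop. 4.6 (1) (l. 1982)] [cite: Shimura1998, §6.2 Theorem 4] -/
private theorem exists_linearEquiv_forall₂_eq_trace (hρ : ∀ x, ρ (ρ x) = x)
    (hN : ∀ h : E ⊗[ℚ] K, Algebra.TensorProduct.map (AlgHom.id E E) ρ h = h →
      ∃ a : E ⊗[ℚ] K, a * Algebra.TensorProduct.map (AlgHom.id E E) ρ a = h)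
    {H : Type} [AddCommGroup H] [Module E H] [Module (E ⊗[ℚ] K) H] [IsScalarTower E (E ⊗[ℚ] K) H]
    (e : (E ⊗[ℚ] K) ≃ₗ[E ⊗[ℚ] K] H) (B : LinearMap.BilinForm E H)
    (hRos : ∀ (x : K) (u v : H), B (((1 : E) ⊗ₜ[ℚ] x) • u) v = B u (((1 : E) ⊗ₜ[ℚ] ρ x) • v))
    (hAlt : B.IsAlt) (hNd : B.Nondegenerate) (β : K) (hβ : ρ β = -β) (hβ0 : β ≠ 0) :
    ∃ r : (E ⊗[ℚ] K) ≃ₗ[E ⊗[ℚ] K] H, ∀ x y : E ⊗[ℚ] K,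
      B (r x) (r y) =
        Algebra.trace E (E ⊗[ℚ] K) (x * ((1 : E) ⊗ₜ[ℚ] β) * Algebra.TensorProduct.map (AlgHom.id E E) ρ y) := by
  classical
  set bar := Algebra.TensorProduct.map (AlgHom.id E E) ρ with hbar
  have hbb : ∀ z, bar (bar z) = z := map_map_tensorProduct_of_involutive ρ hρ
  -- pull `B` back to `L` along `e`
  let eE : (E ⊗[ℚ] K) ≃ₗ[E] H := e.restrictScalars E
  let B₀ : LinearMap.BilinForm E (E ⊗[ℚ] K) := B.comp eE.toLinearMap eE.toLinearMap
  have hB₀ : ∀ x y, B₀ x y = B (e x) (e y) := fun x y => rfl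
  have hB₀K : ∀ (x : K) (u v : E ⊗[ℚ] K),
      B₀ (((1 : E) ⊗ₜ[ℚ] x) * u) v = B₀ u (((1 : E) ⊗ₜ[ℚ] ρ x) * v) := by
    intro x u v
    rw [hB₀, hB₀, ← smul_eq_mul, ← smul_eq_mul, LinearEquiv.map_smul, LinearEquiv.map_smul, hRos]
  obtain ⟨β₀, hβ₀⟩ := exists_forall₂_eq_trace ρ hρ B₀ hB₀K
  have hAlt₀ : B₀.IsAlt := fun x => by
    change B (e x) (e x) = 0
    exact hAlt (e x)
  have hanti : bar β₀ = -β₀ := map_eq_neg_of_isAlt ρ hρ B₀ hβ₀ hAlt₀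
  have hsep : ∀ y : E ⊗[ℚ] K, (∀ x, B₀ x y = 0) → y = 0 := by
    intro y hy
    have hy' : ∀ u : H, B u (e y) = 0 := fun u => by
      have h := hy (e.symm u)
      rwa [hB₀, LinearEquiv.apply_symm_apply] at h
    have h0 : e y = 0 := hNd.2 (e y) hy'
    exact e.injective (by rw [h0, map_zero])
  have hunit : IsUnit β₀ := isUnit_of_separatingRight ρ hρ B₀ hβ₀ hsep
  obtain ⟨u, hu⟩ := hunit
  -- `(1 ⊗ β) β₀⁻¹` is `bar`-fixed, hence a norm `a ā`
  have hbinv : bar ↑u⁻¹ = -↑u⁻¹ := map_units_inv_eq_neg bar u (by rw [hu, hanti])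
  set h : E ⊗[ℚ] K := ((1 : E) ⊗ₜ[ℚ] β) * ↑u⁻¹ with hh
  have hβ' : bar ((1 : E) ⊗ₜ[ℚ] β) = -((1 : E) ⊗ₜ[ℚ] β) := by
    rw [hbar, Algebra.TensorProduct.map_tmul, AlgHom.id_apply, hβ, TensorProduct.tmul_neg]
  have hfix : bar h = h := by
    rw [hh, map_mul bar, hbinv, hβ']
    ring
  obtain ⟨a, ha⟩ := hN h hfix
  have hkey : a * bar a * β₀ = (1 : E) ⊗ₜ[ℚ] β := by
    rw [ha, hh, mul_assoc, ← hu, Units.inv_mul, mul_one]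
  have hβu : IsUnit (((1 : E) ⊗ₜ[ℚ] β : E ⊗[ℚ] K)) :=
    IsUnit.of_mul_eq_one ((1 : E) ⊗ₜ[ℚ] β⁻¹) (by
      rw [Algebra.TensorProduct.tmul_mul_tmul, one_mul, mul_inv_cancel₀ hβ0, ← Algebra.TensorProduct.one_def])
  have haU : IsUnit a := by
    have hprod : IsUnit (a * bar a) := by
      rw [ha, hh]
      exact hβu.mul (Units.isUnit _)
    exact isUnit_of_mul_isUnit_left hprod
  obtain ⟨au, hau⟩ := haU
  -- `r := e ∘ (· * a)`
  let mulA : (E ⊗[ℚ] K) ≃ₗ[E ⊗[ℚ] K] (E ⊗[ℚ] K) :=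
    { toFun := fun x => x * a
      invFun := fun x => x * ↑au⁻¹
      map_add' := fun x y => add_mul x y a
      map_smul' := fun c x => by rw [smul_eq_mul, RingHom.id_apply, smul_eq_mul, mul_assoc]
      left_inv := fun x => by
        change x * a * ↑au⁻¹ = x
        rw [← hau, mul_assoc, Units.mul_inv, mul_one]
      right_inv := fun x => by
        change x * ↑au⁻¹ * a = x
        rw [← hau, mul_assoc, Units.inv_mul, mul_one] }
  refine ⟨mulA.trans e, fun x y => ?_⟩
  rw [LinearEquiv.trans_apply, LinearEquiv.trans_apply]
  change B (e (x * a)) (e (y * a)) = _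
  rw [← hB₀, hβ₀, map_mul bar]
  change Algebra.trace E (E ⊗[ℚ] K) (x * a * β₀ * (bar y * bar a)) =
    Algebra.trace E (E ⊗[ℚ] K) (x * ((1 : E) ⊗ₜ[ℚ] β) * bar y)
  rw [← hkey]
  congr 1
  ring

end RosatiForms

/-! ## §4 Liu's data: `K = M_μ ⊆ ℂ`, `ρ` = complex conjugation, `E = F` a CM field Galois over `ℚ` — EVERY face -/

section Liu

open Literature.NumberTheory.ComplexMultiplication
open Literature.NumberTheory.Automorphic.IdeleClassGroup

variable {F : Type} [Field F] [NumberField F] [IsCMField F] {μ : IdeleClassGroup F →ₜ* Circle}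

omit [IsCMField F] in
/-- Any `ℚ`-algebra endomorphism of `M_μ ⊆ ℂ` inducing complex conjugation (`Def45.exists_conj_algHom_muAlgValueField`) is an
involution. [cite: Liu2021, §4.1 (TeX l. 1928)] -/
theorem conj_algHom_involutive (ρ : muAlgValueField F μ →ₐ[ℚ] muAlgValueField F μ)
    (hρ : ∀ x, ((ρ x : muAlgValueField F μ) : ℂ) = conj (x : ℂ)) (x : muAlgValueField F μ) : ρ (ρ x) = x :=
  Subtype.ext (by rw [hρ, hρ, Complex.conj_conj])

/-- **The norm lemma of `Def45RMuGalois` in the scalar-left orientation `F ⊗_ℚ M_μ`**: for `F` a CM field Galois over `ℚ`,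
`μ` any conjugate symplectic character and `ρ` complex conjugation on `M_μ`, every `(1 ⊗ ρ)`-fixed element of
`F ⊗_ℚ M_μ` is a norm `a · (1 ⊗ ρ) a` (transport of `exists_mul_map_eq_muAlgValueField` along `Algebra.TensorProduct.comm`).
[cite: Liu2021, Def. 4.5 (2) fourth bullet (TeX l. 1957) and proof of Prop. 4.6 (1) (l. 1982)] -/
theorem exists_mul_map_eq_muAlgValueField_left [IsGalois ℚ F] (hμ : IdeleClassGroup.IsConjugateSymplectic F μ)
    (ρ : muAlgValueField F μ →ₐ[ℚ] muAlgValueField F μ)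
    (hρ : ∀ x, ((ρ x : muAlgValueField F μ) : ℂ) = conj (x : ℂ))
    (h : F ⊗[ℚ] muAlgValueField F μ) (hh : Algebra.TensorProduct.map (AlgHom.id F F) ρ h = h) :
    ∃ a : F ⊗[ℚ] muAlgValueField F μ, a * Algebra.TensorProduct.map (AlgHom.id F F) ρ a = h := by
  set comm := Algebra.TensorProduct.comm ℚ F (muAlgValueField F μ) with hcomm
  have hnat : ∀ z, comm (Algebra.TensorProduct.map (AlgHom.id F F) ρ z) =
      Algebra.TensorProduct.map ρ (AlgHom.id ℚ F) (comm z) := by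
    intro z
    induction z using TensorProduct.induction_on with
    | zero => simp
    | tmul a b =>
      rw [Algebra.TensorProduct.map_tmul, hcomm, Algebra.TensorProduct.comm_tmul, Algebra.TensorProduct.comm_tmul,
        Algebra.TensorProduct.map_tmul, AlgHom.id_apply, AlgHom.id_apply]
    | add x y hx hy => rw [map_add, map_add, hx, hy, map_add, map_add]
  obtain ⟨a', ha'⟩ := exists_mul_map_eq_muAlgValueField hμ ρ hρ (comm h) (by rw [← hnat, hh])
  refine ⟨comm.symm a', comm.injective ?_⟩
  rw [map_mul comm, hnat, AlgEquiv.apply_symm_apply, ha']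

/-- **[Liu2021, Def. 4.5 (2) fourth bullet] — `r_μ` EXISTS, as printed, for every abstract de Rham datum at EVERY face of a
Galois CM field.**  `F` a CM field Galois over `ℚ` (Liu's `E`), `μ` ANY conjugate symplectic character, `K = M_μ ⊆ ℂ`
(`muAlgValueField`), `ρ` complex conjugation on `M_μ`, `L = F ⊗_ℚ M_μ` (= Liu's `M_μ ⊗_ℚ E` up to `Algebra.TensorProduct.comm`),
`ȳ = (1 ⊗ ρ) y`.  For EVERY `L`-module `H` free of rank one (`e : L ≃ₗ[L] H`; read `H = H_1^{dR}(A_μ/E)`), EVERY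
`F`-bilinear form `B` on `H` (read `B = c ∘ ⟨ , ⟩_λ`) that is alternating, non-degenerate and satisfies the third-bullet
adjunction `B((1 ⊗ x) u, v) = B(u, (1 ⊗ x̄) v)` (`x ∈ M_μ`), and EVERY `β ∈ M_μ` with `ρ β = -β`, `β ≠ 0`, there is an
`L`-linear isomorphism `r : L ≃ H` with `B(r x, r y) = Tr_{L/F}(x (1 ⊗ β) ȳ)` for all `x, y ∈ L`.  «The existence of `r_μ`
is obvious» (l. 1982) thus holds at every admitted face for every model of the de Rham carrier; what is NOT constructed
here is that carrier (algebraic de Rham homology of `A_μ/E` with its `M_μ`-action and `λ`-pairing).  Composition of §3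
with the norm lemma of `Def45RMuGalois` (§4 `exists_mul_map_eq_muAlgValueField_left`).
[cite: Liu2021, Def. 4.5 (2) fourth bullet (TeX l. 1957) and proof of Prop. 4.6 (1) (l. 1982 «The existence of r_μ is obvious»)]
[cite: Shimura1998, §6.2 Theorem 4] [cite: Deligne1982HodgeCycles, §4 Lemma 4.3 (a)] -/
theorem exists_linearEquiv_forall₂_eq_trace_muAlgValueField [IsGalois ℚ F]
    (hμ : IdeleClassGroup.IsConjugateSymplectic F μ)
    (ρ : muAlgValueField F μ →ₐ[ℚ] muAlgValueField F μ)
    (hρ : ∀ x, ((ρ x : muAlgValueField F μ) : ℂ) = conj (x : ℂ))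
    {H : Type} [AddCommGroup H] [Module F H] [Module (F ⊗[ℚ] muAlgValueField F μ) H]
    [IsScalarTower F (F ⊗[ℚ] muAlgValueField F μ) H]
    (e : (F ⊗[ℚ] muAlgValueField F μ) ≃ₗ[F ⊗[ℚ] muAlgValueField F μ] H) (B : LinearMap.BilinForm F H)
    (hRos : ∀ (x : muAlgValueField F μ) (u v : H),
      B (((1 : F) ⊗ₜ[ℚ] x) • u) v = B u (((1 : F) ⊗ₜ[ℚ] ρ x) • v))
    (hAlt : B.IsAlt) (hNd : B.Nondegenerate)
    (β : muAlgValueField F μ) (hβ : ρ β = -β) (hβ0 : β ≠ 0) :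
    ∃ r : (F ⊗[ℚ] muAlgValueField F μ) ≃ₗ[F ⊗[ℚ] muAlgValueField F μ] H,
      ∀ x y : F ⊗[ℚ] muAlgValueField F μ,
        B (r x) (r y) = Algebra.trace F (F ⊗[ℚ] muAlgValueField F μ)
          (x * ((1 : F) ⊗ₜ[ℚ] β) * Algebra.TensorProduct.map (AlgHom.id F F) ρ y) := by
  haveI := hμ.numberField_muAlgValueField
  exact exists_linearEquiv_forall₂_eq_trace ρ (conj_algHom_involutive ρ hρ)
    (exists_mul_map_eq_muAlgValueField_left hμ ρ hρ) e B hRos hAlt hNd β hβ hβ0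

end Liu

end Literature.NumberTheory.Automorphic.Liu2021.Def45

end
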